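import Literature.NumberTheory.Automorphic.InducedWhittakerVanishing
import Literature.NumberTheory.Automorphic.ParabolicSemidirect
import HarnessLib

/-!
# The open `(P_c, U_n)`-cell of `GL_n(F)`: coordinates `p · w₀ · n'`

Topic `NumberTheory/Automorphic`. For a monotone block labelling `c : Fin n → α` with standard
parabolic `P = P_c` and the longest Weyl element `w₀ = P_{rev}` (the permutation matrix of
`Fin.revPerm`), the open double coset `P w₀ U_n` (`parabolicDoubleCoset c Fin.revPerm`, open by
`ParabolicBruhatCellsTopology`) is parametrised bijectively by `P × N'`, where

* `revLabel c = c ∘ Fin.rev` is the reversed (antitone) labelling,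
* `N' = oppositeCellRadical c = unipotentRadicalGL F (toDual ∘ revLabel c)` is the unipotent
  radical of the *reversed* standard parabolic `P' = P_{toDual ∘ revLabel c}` (blocks of `c` in
  the opposite order), and
* `A' = cellLeviUnipotent c = U_n ⊓ P_{revLabel c}` is the group of upper unitriangular matrices
  which are block diagonal for the reversed blocks, i.e. `U_n ∩ w₀⁻¹ P w₀`
  (`mem_cellLeviUnipotent_iff_conj_mem`).

Results (all proved):

* `conj_mem_standardParabolicGL_of_mem_cellLeviUnipotent` (`w₀ A' w₀⁻¹ ≤ P`),
  `conj_mem_lower_of_mem_oppositeCellRadical` (`w₀ N' w₀⁻¹ ≤ N_c⁻ = unipotentRadicalGL (toDual ∘ c)`);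
* `cellLeviPart` / `cellRadicalPart` — the decomposition `u = ℓ(u) · n(u)` of `u ∈ U_n` with
  `ℓ(u) ∈ A'`, `n(u) ∈ N'` (the Levi decomposition of `P'` restricted to `U_n ≤ P'`), continuity
  of `n`, `A' ∩ N' = 1`;
* `eq_of_parabolic_mul_w₀_mul_eq` — **uniqueness** `p w₀ n'₁ = p' w₀ n'₂ → p = p' ∧ n'₁ = n'₂`
  (`P ∩ N_c⁻ = 1`), and `mem_parabolicDoubleCoset_rev_iff` — `P w₀ U_n = {p w₀ n' : p ∈ P, n' ∈ N'}`;
* `openCellP`, `openCellN` — the coordinate functions on the open cell, with their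
  specification and equivariance `(p₀ g) ↦ (p₀ p, n')`, `(g n₀) ↦ (p, n' n₀)`,
  `(g m) ↦ (p · w₀ m w₀⁻¹, m⁻¹ n' m)` for `m ∈ A'`.

This is the standard description of the big cell `P w₀ B = P w₀ N'` (e.g. Borel 1991, 14.12,
21.15; for `GL_n`, Bernstein–Zelevinsky 1977, §6 (proof of the geometric lemma), the open
`Q`-orbit on `P \ G`). Definitions have bodies; no named fact.

## References

* I. N. Bernstein, A. V. Zelevinsky, *Induced representations of reductive `p`-adic groups I*,
  Ann. Sci. ÉNS 10 (1977), §5–6 (the open orbit in the geometric lemma). [BernsteinZelevinskyASENS1977]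
* G. Malle, D. Testerman, *Linear Algebraic Groups and Finite Groups of Lie Type* (2011),
  Thm. 11.17, Prop. 11.20 ff. (`U⁻ = ẇ₀ U ẇ₀`, the big cell `U⁻ B`). [MalleTesterman2011]
-/

open scoped Pointwise
open Matrix OrderDual Topology

namespace Literature.NumberTheory.Automorphic

section Algebra

variable {K : Type*} [Field K] {n : ℕ} {α : Type*} [LinearOrder α] (c : Fin n → α)

/-! ### The reversed labelling and the groups `A'`, `N'` -/

/-- The **reversed labelling** `revLabel c i = c (rev i)`: the block word of the longest element.
[folklore] -/
def revLabel : Fin n → α := fun i => c (Fin.rev i)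

omit [LinearOrder α] in
/-- `revLabel c i = c (rev i)`. [folklore] -/
@[simp] lemma revLabel_apply (i : Fin n) : revLabel c i = c (Fin.rev i) := rfl

omit [LinearOrder α] in
/-- `c ∘ revPerm⁻¹ = revLabel c`. [folklore] -/
lemma comp_revPerm_symm : c ∘ ⇑(Fin.revPerm.symm : Equiv.Perm (Fin n)) = revLabel c := by
  funext i
  simp [revLabel]

omit [LinearOrder α] in
/-- `(toDual ∘ c) ∘ revPerm⁻¹ = toDual ∘ revLabel c`. [folklore] -/
lemma toDual_comp_revPerm_symm :
    (⇑toDual ∘ c) ∘ ⇑(Fin.revPerm.symm : Equiv.Perm (Fin n)) = ⇑toDual ∘ revLabel c := by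
  funext i
  simp [revLabel]

/-- For a monotone `c`, `toDual ∘ revLabel c` is monotone (the reversed blocks in increasing
order). [folklore] -/
lemma monotone_toDual_revLabel (hc : Monotone c) : Monotone (⇑toDual ∘ revLabel c) :=
  fun _ _ hij => toDual_le_toDual.2 (hc (Fin.rev_le_rev.2 hij))

/-- The **unipotent radical of the reversed parabolic**, `N' = N_{toDual ∘ revLabel c}`: block
strictly upper triangular matrices for the blocks of `c` in reversed order. [folklore] -/
def oppositeCellRadical : Subgroup (GL (Fin n) K) := unipotentRadicalGL K (⇑toDual ∘ revLabel c)

/-- The **unipotent part of the reversed Levi inside `U_n`**, `A' = U_n ⊓ P_{revLabel c}`: upper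
unitriangular matrices which are block diagonal for the reversed blocks. [folklore] -/
def cellLeviUnipotent : Subgroup (GL (Fin n) K) :=
  upperUnitriangular (Fin n) K ⊓ standardParabolicGL K (revLabel c)

/-- `N' ≤ U_n`. [folklore] -/
lemma oppositeCellRadical_le (hc : Monotone c) :
    oppositeCellRadical (K := K) c ≤ upperUnitriangular (Fin n) K := by
  intro g hg
  rw [oppositeCellRadical, mem_unipotentRadicalGL_iff_apply] at hg
  rw [mem_upperUnitriangular_iff]
  refine ⟨fun i j hij => ?_, fun i => ?_⟩
  · have : (⇑toDual ∘ revLabel c) j ≤ (⇑toDual ∘ revLabel c) i :=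
      monotone_toDual_revLabel c hc (le_of_lt hij)
    rw [hg i j this, Matrix.one_apply_ne (ne_of_gt (show j < i from hij))]
  · rw [hg i i le_rfl, Matrix.one_apply_eq]

/-- `A' ≤ U_n`. [folklore] -/
lemma cellLeviUnipotent_le : cellLeviUnipotent (K := K) c ≤ upperUnitriangular (Fin n) K :=
  inf_le_left

/-- `U_n ≤ P' = P_{toDual ∘ revLabel c}` for monotone `c`. [folklore] -/
lemma upperUnitriangular_le_reversedParabolic (hc : Monotone c) :
    upperUnitriangular (Fin n) K ≤ standardParabolicGL K (⇑toDual ∘ revLabel c) :=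
  (unipotentRadicalGL_le K (_root_.id : Fin n → Fin n)).trans
    (borel_le_standardParabolicGL (monotone_toDual_revLabel c hc))

/-- `N' ≤ P'`. [folklore] -/
lemma oppositeCellRadical_le_reversedParabolic :
    oppositeCellRadical (K := K) c ≤ standardParabolicGL K (⇑toDual ∘ revLabel c) :=
  unipotentRadicalGL_le K _

/-- **`A' ∩ N' = 1`**: a block diagonal, block strictly upper triangular matrix is `1`. [folklore] -/
theorem eq_one_of_mem_cellLeviUnipotent_of_mem_oppositeCellRadical {g : GL (Fin n) K}
    (hA : g ∈ cellLeviUnipotent (K := K) c) (hN : g ∈ oppositeCellRadical (K := K) c) : g = 1 :=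
  eq_one_of_mem_standardParabolicGL_of_mem_lower (revLabel c) hA.2 hN

/-! ### Conjugation by `w₀` -/

/-- `m ∈ A'` iff `m ∈ U_n` and `w₀ m w₀⁻¹ ∈ P_c`. [folklore] -/
theorem mem_cellLeviUnipotent_iff_conj_mem (m : GL (Fin n) K) :
    m ∈ cellLeviUnipotent (K := K) c ↔ m ∈ upperUnitriangular (Fin n) K ∧
      permGL Fin.revPerm * m * (permGL Fin.revPerm)⁻¹ ∈ standardParabolicGL K c := by
  rw [cellLeviUnipotent, Subgroup.mem_inf, permGL_mul_mul_inv_mem_standardParabolicGL_iff,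
    comp_revPerm_symm]

/-- **`w₀ A' w₀⁻¹ ≤ P_c`.** [folklore] -/
theorem conj_mem_standardParabolicGL_of_mem_cellLeviUnipotent {m : GL (Fin n) K}
    (hm : m ∈ cellLeviUnipotent (K := K) c) :
    permGL Fin.revPerm * m * (permGL Fin.revPerm)⁻¹ ∈ standardParabolicGL K c :=
  ((mem_cellLeviUnipotent_iff_conj_mem c m).1 hm).2

/-- **`w₀ N' w₀⁻¹ ≤ N_c⁻ = unipotentRadicalGL (toDual ∘ c)`** (the radical opposite to `P_c`).
[folklore] -/
theorem conj_mem_lower_of_mem_oppositeCellRadical {g : GL (Fin n) K}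
    (hg : g ∈ oppositeCellRadical (K := K) c) :
    permGL Fin.revPerm * g * (permGL Fin.revPerm)⁻¹ ∈ unipotentRadicalGL K (⇑toDual ∘ c) := by
  rw [permGL_mul_mul_inv_mem_unipotentRadicalGL_iff, toDual_comp_revPerm_symm]
  exact hg

/-- Conversely `w₀⁻¹ N_c⁻ w₀ ≤ N'`. [folklore] -/
theorem inv_mul_mul_mem_oppositeCellRadical {g : GL (Fin n) K}
    (hg : g ∈ unipotentRadicalGL K (⇑toDual ∘ c)) :
    (permGL Fin.revPerm)⁻¹ * g * permGL Fin.revPerm ∈ oppositeCellRadical (K := K) c := by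
  have : permGL Fin.revPerm * ((permGL Fin.revPerm)⁻¹ * g * permGL Fin.revPerm) *
      (permGL Fin.revPerm)⁻¹ = g := by group
  rw [oppositeCellRadical, ← toDual_comp_revPerm_symm,
    ← permGL_mul_mul_inv_mem_unipotentRadicalGL_iff, this]
  exact hg

/-- **Uniqueness of the coordinates on the open cell**: `p w₀ n'₁ = p' w₀ n'₂` with `p, p' ∈ P_c`,
`n'₁, n'₂ ∈ N'` forces `p = p'` and `n'₁ = n'₂` (because `P_c ∩ N_c⁻ = 1`). [folklore] -/
theorem eq_of_parabolic_mul_w₀_mul_eq {p p' n₁ n₂ : GL (Fin n) K}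
    (hp : p ∈ standardParabolicGL K c) (hp' : p' ∈ standardParabolicGL K c)
    (hn₁ : n₁ ∈ oppositeCellRadical (K := K) c) (hn₂ : n₂ ∈ oppositeCellRadical (K := K) c)
    (h : p * permGL Fin.revPerm * n₁ = p' * permGL Fin.revPerm * n₂) : p = p' ∧ n₁ = n₂ := by
  have key : p'⁻¹ * p = permGL Fin.revPerm * (n₂ * n₁⁻¹) * (permGL Fin.revPerm)⁻¹ := by
    calc p'⁻¹ * p = p'⁻¹ * (p * permGL Fin.revPerm * n₁) * n₁⁻¹ * (permGL Fin.revPerm)⁻¹ := by group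
      _ = p'⁻¹ * (p' * permGL Fin.revPerm * n₂) * n₁⁻¹ * (permGL Fin.revPerm)⁻¹ := by rw [h]
      _ = permGL Fin.revPerm * (n₂ * n₁⁻¹) * (permGL Fin.revPerm)⁻¹ := by group
  have hP : p'⁻¹ * p ∈ standardParabolicGL K c := Subgroup.mul_mem _ (Subgroup.inv_mem _ hp') hp
  have hN : p'⁻¹ * p ∈ unipotentRadicalGL K (⇑toDual ∘ c) := by
    rw [key]
    exact conj_mem_lower_of_mem_oppositeCellRadical c
      (Subgroup.mul_mem _ hn₂ (Subgroup.inv_mem _ hn₁))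
  have h1 : p'⁻¹ * p = 1 := eq_one_of_mem_standardParabolicGL_of_mem_lower c hP hN
  have hpp' : p = p' := by
    calc p = p' * (p'⁻¹ * p) := by group
      _ = p' := by rw [h1, mul_one]
  refine ⟨hpp', ?_⟩
  rw [hpp'] at h
  exact mul_left_cancel h

/-! ### The Levi decomposition of `U_n ≤ P'`: `u = ℓ(u) · n(u)` -/

variable [Fintype α]

/-- The **block diagonal part** `ℓ(u) ∈ A'` of `u ∈ U_n` for the reversed blocks (the Levi
projection of the reversed parabolic `P'`, re-embedded). [folklore] -/
noncomputable def cellLeviPart (hc : Monotone c) (u : ↥(upperUnitriangular (Fin n) K)) : GL (Fin n) K :=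
  leviEmbedding K (⇑toDual ∘ revLabel c)
    (leviProjection K (⇑toDual ∘ revLabel c) ⟨u, upperUnitriangular_le_reversedParabolic c hc u.2⟩)

/-- Entries of the block diagonal part: `ℓ(u)_{ij} = u_{ij}` inside a reversed block, `0` outside.
[folklore] -/
theorem cellLeviPart_apply (hc : Monotone c) (u : ↥(upperUnitriangular (Fin n) K)) (i j : Fin n) :
    ((cellLeviPart c hc u : GL (Fin n) K) : Matrix (Fin n) (Fin n) K) i j =
      if revLabel c i = revLabel c j then ((u : GL (Fin n) K) : Matrix (Fin n) (Fin n) K) i j else 0 := by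
  rw [cellLeviPart, leviEmbedding_apply, blockDiagonalGL_apply_coe_dite]
  by_cases h : (⇑toDual ∘ revLabel c) i = (⇑toDual ∘ revLabel c) j
  · have h' : revLabel c i = revLabel c j := toDual_inj.1 h
    rw [dif_pos h, if_pos h']
    rfl
  · have h' : revLabel c i ≠ revLabel c j := fun h' => h (congrArg (⇑toDual) h')
    rw [dif_neg h, if_neg h']

/-- `ℓ(u) ∈ A'`. [folklore] -/
theorem cellLeviPart_mem (hc : Monotone c) (u : ↥(upperUnitriangular (Fin n) K)) :
    cellLeviPart c hc u ∈ cellLeviUnipotent (K := K) c := by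
  obtain ⟨huT, hu1⟩ := (mem_upperUnitriangular_iff _).1 u.2
  refine ⟨(mem_upperUnitriangular_iff _).2 ⟨fun i j hij => ?_, fun i => ?_⟩, fun i j hij => ?_⟩
  · rw [cellLeviPart_apply]
    split_ifs
    · exact huT hij
    · rfl
  · rw [cellLeviPart_apply, if_pos rfl, hu1]
  · rw [cellLeviPart_apply, if_neg (ne_of_gt hij)]

/-- The **radical part** `n(u) = ℓ(u)⁻¹ u ∈ N'` of `u ∈ U_n`. [folklore] -/
noncomputable def cellRadicalPart (hc : Monotone c) (u : ↥(upperUnitriangular (Fin n) K)) : GL (Fin n) K :=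
  (cellLeviPart c hc u)⁻¹ * u

/-- `u = ℓ(u) · n(u)`. [folklore] -/
theorem cellLeviPart_mul_cellRadicalPart (hc : Monotone c) (u : ↥(upperUnitriangular (Fin n) K)) :
    cellLeviPart c hc u * cellRadicalPart c hc u = u := by
  rw [cellRadicalPart, mul_inv_cancel_left]

/-- `n(u) ∈ N'`. [folklore] -/
theorem cellRadicalPart_mem (hc : Monotone c) (u : ↥(upperUnitriangular (Fin n) K)) :
    cellRadicalPart c hc u ∈ oppositeCellRadical (K := K) c := by
  have h := leviEmbeddingP_inv_mul_mem_unipotentRadicalP (R := K) (c := ⇑toDual ∘ revLabel c)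
    ⟨u, upperUnitriangular_le_reversedParabolic c hc u.2⟩
  refine ⟨_, h, ?_⟩
  rw [cellRadicalPart, cellLeviPart, leviEmbedding_apply, Subgroup.coe_subtype, Subgroup.coe_mul,
    Subgroup.coe_inv, coe_leviEmbeddingP]

/-- `n(u) ∈ U_n`. [folklore] -/
theorem cellRadicalPart_mem_upperUnitriangular (hc : Monotone c) (u : ↥(upperUnitriangular (Fin n) K)) :
    cellRadicalPart c hc u ∈ upperUnitriangular (Fin n) K :=
  oppositeCellRadical_le c hc (cellRadicalPart_mem c hc u)

/-- For `a ∈ A'` and `n' ∈ N'`: `n(a n') = n'`. [folklore] -/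
theorem cellRadicalPart_eq_of_mem {a n' : GL (Fin n) K} (hc : Monotone c)
    (ha : a ∈ cellLeviUnipotent (K := K) c) (hn' : n' ∈ oppositeCellRadical (K := K) c) :
    cellRadicalPart c hc ⟨a * n', Subgroup.mul_mem _ (cellLeviUnipotent_le c ha)
      (oppositeCellRadical_le c hc hn')⟩ = n' := by
  -- `ℓ(a n') n(a n') = a n'` with `ℓ ∈ A'`, `n ∈ N'`: compare with the decomposition `a · n'`
  set u : ↥(upperUnitriangular (Fin n) K) := ⟨a * n', Subgroup.mul_mem _ (cellLeviUnipotent_le c ha)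
      (oppositeCellRadical_le c hc hn')⟩ with hu
  have h1 := cellLeviPart_mul_cellRadicalPart c hc u
  have h2 : a⁻¹ * cellLeviPart c hc u = n' * (cellRadicalPart c hc u)⁻¹ := by
    have h1' : cellLeviPart c hc u * cellRadicalPart c hc u = a * n' := h1
    calc a⁻¹ * cellLeviPart c hc u
        = a⁻¹ * (cellLeviPart c hc u * cellRadicalPart c hc u) * (cellRadicalPart c hc u)⁻¹ := by group
      _ = n' * (cellRadicalPart c hc u)⁻¹ := by rw [h1']; group
  have hA : a⁻¹ * cellLeviPart c hc u ∈ cellLeviUnipotent (K := K) c :=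
    Subgroup.mul_mem _ (Subgroup.inv_mem _ ha) (cellLeviPart_mem c hc u)
  have hN : a⁻¹ * cellLeviPart c hc u ∈ oppositeCellRadical (K := K) c := by
    rw [h2]
    exact Subgroup.mul_mem _ hn' (Subgroup.inv_mem _ (cellRadicalPart_mem c hc u))
  have h3 := eq_one_of_mem_cellLeviUnipotent_of_mem_oppositeCellRadical c hA hN
  rw [h2, mul_inv_eq_one] at h3
  exact h3.symm

/-! ### The open cell `P w₀ U_n = P w₀ N'` and its coordinates -/

/-- **The open cell is `P w₀ N'`**: `g ∈ P_c P_{w₀} U_n` iff `g = p w₀ n'` with `p ∈ P_c`, `n' ∈ N'`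
(move the block diagonal part `ℓ(u)` of `u` across `w₀` into `P_c`). [folklore] -/
theorem mem_parabolicDoubleCoset_rev_iff (hc : Monotone c) (g : GL (Fin n) K) :
    g ∈ parabolicDoubleCoset (K := K) c Fin.revPerm ↔
      ∃ p ∈ standardParabolicGL K c, ∃ n' ∈ oppositeCellRadical (K := K) c,
        g = p * permGL Fin.revPerm * n' := by
  constructor
  · rintro ⟨p, hp, u, hu, rfl⟩
    refine ⟨p * (permGL Fin.revPerm * cellLeviPart c hc ⟨u, hu⟩ * (permGL Fin.revPerm)⁻¹),
      Subgroup.mul_mem _ hp (conj_mem_standardParabolicGL_of_mem_cellLeviUnipotent c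
        (cellLeviPart_mem c hc ⟨u, hu⟩)),
      cellRadicalPart c hc ⟨u, hu⟩, cellRadicalPart_mem c hc ⟨u, hu⟩, ?_⟩
    have := cellLeviPart_mul_cellRadicalPart c hc ⟨u, hu⟩
    calc p * permGL Fin.revPerm * u
        = p * permGL Fin.revPerm * (cellLeviPart c hc ⟨u, hu⟩ * cellRadicalPart c hc ⟨u, hu⟩) := by
          rw [this]
      _ = _ := by group
  · rintro ⟨p, hp, n', hn', rfl⟩
    exact ⟨p, hp, n', oppositeCellRadical_le c hc hn', rfl⟩

variable {c}

/-- The `P_c`-coordinate of a point of the open cell (a choice; unique by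
`eq_of_parabolic_mul_w₀_mul_eq`). [folklore] -/
noncomputable def openCellP (hc : Monotone c) {g : GL (Fin n) K}
    (hg : g ∈ parabolicDoubleCoset (K := K) c Fin.revPerm) : GL (Fin n) K :=
  Classical.choose ((mem_parabolicDoubleCoset_rev_iff c hc g).1 hg)

/-- The `N'`-coordinate of a point of the open cell. [folklore] -/
noncomputable def openCellN (hc : Monotone c) {g : GL (Fin n) K}
    (hg : g ∈ parabolicDoubleCoset (K := K) c Fin.revPerm) : GL (Fin n) K :=
  Classical.choose (Classical.choose_spec ((mem_parabolicDoubleCoset_rev_iff c hc g).1 hg)).2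

/-- `openCellP hg ∈ P_c`. [folklore] -/
lemma openCellP_mem (hc : Monotone c) {g : GL (Fin n) K}
    (hg : g ∈ parabolicDoubleCoset (K := K) c Fin.revPerm) : openCellP hc hg ∈ standardParabolicGL K c :=
  (Classical.choose_spec ((mem_parabolicDoubleCoset_rev_iff c hc g).1 hg)).1

/-- `openCellN hg ∈ N'`. [folklore] -/
lemma openCellN_mem (hc : Monotone c) {g : GL (Fin n) K}
    (hg : g ∈ parabolicDoubleCoset (K := K) c Fin.revPerm) :
    openCellN hc hg ∈ oppositeCellRadical (K := K) c :=
  (Classical.choose_spec (Classical.choose_spec ((mem_parabolicDoubleCoset_rev_iff c hc g).1 hg)).2).1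

/-- `g = openCellP hg · w₀ · openCellN hg`. [folklore] -/
lemma openCellP_mul_w₀_mul_openCellN (hc : Monotone c) {g : GL (Fin n) K}
    (hg : g ∈ parabolicDoubleCoset (K := K) c Fin.revPerm) :
    openCellP hc hg * permGL Fin.revPerm * openCellN hc hg = g :=
  (Classical.choose_spec (Classical.choose_spec ((mem_parabolicDoubleCoset_rev_iff c hc g).1 hg)).2).2.symm

/-- The coordinates only depend on the point, not on the membership proof or on how the point
is written. [folklore] -/
lemma openCellN_congr (hc : Monotone c) {g g' : GL (Fin n) K} (h : g = g')
    (hg : g ∈ parabolicDoubleCoset (K := K) c Fin.revPerm)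
    (hg' : g' ∈ parabolicDoubleCoset (K := K) c Fin.revPerm) : openCellN hc hg = openCellN hc hg' := by
  subst h
  rfl

/-- Companion of `openCellN_congr` for the `P_c`-coordinate. [folklore] -/
lemma openCellP_congr (hc : Monotone c) {g g' : GL (Fin n) K} (h : g = g')
    (hg : g ∈ parabolicDoubleCoset (K := K) c Fin.revPerm)
    (hg' : g' ∈ parabolicDoubleCoset (K := K) c Fin.revPerm) : openCellP hc hg = openCellP hc hg' := by
  subst h
  rfl

/-- **The coordinates of `p w₀ n'` are `(p, n')`.** [folklore] -/
theorem openCellP_openCellN_eq (hc : Monotone c) {p n' : GL (Fin n) K}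
    (hp : p ∈ standardParabolicGL K c) (hn' : n' ∈ oppositeCellRadical (K := K) c)
    (hg : p * permGL Fin.revPerm * n' ∈ parabolicDoubleCoset (K := K) c Fin.revPerm) :
    openCellP hc hg = p ∧ openCellN hc hg = n' :=
  eq_of_parabolic_mul_w₀_mul_eq c (openCellP_mem hc hg) hp (openCellN_mem hc hg) hn'
    (openCellP_mul_w₀_mul_openCellN hc hg)

/-- `p w₀ n'` lies in the open cell. [folklore] -/
lemma parabolic_mul_w₀_mul_mem (hc : Monotone c) {p n' : GL (Fin n) K}
    (hp : p ∈ standardParabolicGL K c) (hn' : n' ∈ oppositeCellRadical (K := K) c) :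
    p * permGL Fin.revPerm * n' ∈ parabolicDoubleCoset (K := K) c Fin.revPerm :=
  (mem_parabolicDoubleCoset_rev_iff c hc _).2 ⟨p, hp, n', hn', rfl⟩

/-! ### Equivariance of the coordinates -/

omit [Fintype α] in
/-- `N'` is normalised by `P'`: `m⁻¹ n' m ∈ N'` for `m ∈ P'`, `n' ∈ N'`. [folklore] -/
theorem inv_mul_mul_mem_oppositeCellRadical_of_mem {m n' : GL (Fin n) K}
    (hm : m ∈ standardParabolicGL K (⇑toDual ∘ revLabel c)) (hn' : n' ∈ oppositeCellRadical (K := K) c) :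
    m⁻¹ * n' * m ∈ oppositeCellRadical (K := K) c := by
  obtain ⟨x, hx, rfl⟩ := hn'
  have hx' : (⟨m, hm⟩ : ↥(standardParabolicGL K (⇑toDual ∘ revLabel c)))⁻¹ * x * ⟨m, hm⟩ ∈
      unipotentRadicalP K (⇑toDual ∘ revLabel c) :=
    (MonoidHom.normal_ker (leviProjection K (⇑toDual ∘ revLabel c))).conj_mem' x hx ⟨m, hm⟩
  exact ⟨_, hx', rfl⟩

omit [Fintype α] in
/-- `m n' m⁻¹ ∈ N'` for `m ∈ P'`, `n' ∈ N'`. [folklore] -/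
theorem mul_mul_inv_mem_oppositeCellRadical_of_mem {m n' : GL (Fin n) K}
    (hm : m ∈ standardParabolicGL K (⇑toDual ∘ revLabel c)) (hn' : n' ∈ oppositeCellRadical (K := K) c) :
    m * n' * m⁻¹ ∈ oppositeCellRadical (K := K) c := by
  have := inv_mul_mul_mem_oppositeCellRadical_of_mem (K := K) (c := c) (Subgroup.inv_mem _ hm) hn'
  rwa [inv_inv] at this

/-- **Left `P_c`-equivariance**: the coordinates of `p₀ g` are `(p₀ p, n')`. [folklore] -/
theorem openCellP_openCellN_parabolic_mul (hc : Monotone c) {g p₀ : GL (Fin n) K}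
    (hg : g ∈ parabolicDoubleCoset (K := K) c Fin.revPerm) (hp₀ : p₀ ∈ standardParabolicGL K c)
    (hg' : p₀ * g ∈ parabolicDoubleCoset (K := K) c Fin.revPerm) :
    openCellP hc hg' = p₀ * openCellP hc hg ∧ openCellN hc hg' = openCellN hc hg := by
  have h : p₀ * g = p₀ * openCellP hc hg * permGL Fin.revPerm * openCellN hc hg := by
    rw [mul_assoc, mul_assoc, ← mul_assoc (openCellP hc hg), openCellP_mul_w₀_mul_openCellN hc hg]
  have hmem : p₀ * openCellP hc hg * permGL Fin.revPerm * openCellN hc hg ∈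
      parabolicDoubleCoset (K := K) c Fin.revPerm := h ▸ hg'
  have := openCellP_openCellN_eq hc (Subgroup.mul_mem _ hp₀ (openCellP_mem hc hg))
    (openCellN_mem hc hg) hmem
  constructor
  · rw [← this.1]; congr 1
  · rw [← this.2]; congr 1

/-- **Right `N'`-equivariance**: the coordinates of `g n₀` are `(p, n' n₀)`. [folklore] -/
theorem openCellP_openCellN_mul_radical (hc : Monotone c) {g n₀ : GL (Fin n) K}
    (hg : g ∈ parabolicDoubleCoset (K := K) c Fin.revPerm) (hn₀ : n₀ ∈ oppositeCellRadical (K := K) c)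
    (hg' : g * n₀ ∈ parabolicDoubleCoset (K := K) c Fin.revPerm) :
    openCellP hc hg' = openCellP hc hg ∧ openCellN hc hg' = openCellN hc hg * n₀ := by
  have h : g * n₀ = openCellP hc hg * permGL Fin.revPerm * (openCellN hc hg * n₀) := by
    rw [← mul_assoc, openCellP_mul_w₀_mul_openCellN hc hg]
  have hmem : openCellP hc hg * permGL Fin.revPerm * (openCellN hc hg * n₀) ∈
      parabolicDoubleCoset (K := K) c Fin.revPerm := h ▸ hg'
  have := openCellP_openCellN_eq hc (openCellP_mem hc hg)
    (Subgroup.mul_mem _ (openCellN_mem hc hg) hn₀) hmem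
  constructor
  · rw [← this.1]; congr 1
  · rw [← this.2]; congr 1

/-- **Right `A'`-equivariance**: the coordinates of `g m`, `m ∈ A'`, are
`(p · w₀ m w₀⁻¹, m⁻¹ n' m)`. [folklore] -/
theorem openCellP_openCellN_mul_levi (hc : Monotone c) {g m : GL (Fin n) K}
    (hg : g ∈ parabolicDoubleCoset (K := K) c Fin.revPerm) (hm : m ∈ cellLeviUnipotent (K := K) c)
    (hg' : g * m ∈ parabolicDoubleCoset (K := K) c Fin.revPerm) :
    openCellP hc hg' = openCellP hc hg * (permGL Fin.revPerm * m * (permGL Fin.revPerm)⁻¹) ∧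
      openCellN hc hg' = m⁻¹ * openCellN hc hg * m := by
  have h : g * m = openCellP hc hg * (permGL Fin.revPerm * m * (permGL Fin.revPerm)⁻¹) *
      permGL Fin.revPerm * (m⁻¹ * openCellN hc hg * m) := by
    conv_lhs => rw [← openCellP_mul_w₀_mul_openCellN hc hg]
    group
  have hmem : openCellP hc hg * (permGL Fin.revPerm * m * (permGL Fin.revPerm)⁻¹) *
      permGL Fin.revPerm * (m⁻¹ * openCellN hc hg * m) ∈ parabolicDoubleCoset (K := K) c Fin.revPerm :=
    h ▸ hg'
  have := openCellP_openCellN_eq hc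
    (Subgroup.mul_mem _ (openCellP_mem hc hg) (conj_mem_standardParabolicGL_of_mem_cellLeviUnipotent c hm))
    (inv_mul_mul_mem_oppositeCellRadical_of_mem (upperUnitriangular_le_reversedParabolic c hc
      (cellLeviUnipotent_le c hm)) (openCellN_mem hc hg)) hmem
  constructor
  · rw [← this.1]; congr 1
  · rw [← this.2]; congr 1

omit [Fintype α] in
/-- The open cell is stable under `g ↦ p₀ g`, `p₀ ∈ P_c`. [folklore] -/
lemma parabolic_mul_mem_parabolicDoubleCoset_rev {g p₀ : GL (Fin n) K}
    (hg : g ∈ parabolicDoubleCoset (K := K) c Fin.revPerm) (hp₀ : p₀ ∈ standardParabolicGL K c) :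
    p₀ * g ∈ parabolicDoubleCoset (K := K) c Fin.revPerm := by
  have := mul_mul_mem_parabolicDoubleCoset (K := K) c hg hp₀ (Subgroup.one_mem _)
  rwa [mul_one] at this

omit [Fintype α] in
/-- The open cell is stable under `g ↦ g u`, `u ∈ U_n`. [folklore] -/
lemma mul_upperUnitriangular_mem_parabolicDoubleCoset_rev {g u : GL (Fin n) K}
    (hg : g ∈ parabolicDoubleCoset (K := K) c Fin.revPerm) (hu : u ∈ upperUnitriangular (Fin n) K) :
    g * u ∈ parabolicDoubleCoset (K := K) c Fin.revPerm := by
  have := mul_mul_mem_parabolicDoubleCoset (K := K) c hg (Subgroup.one_mem _) hu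
  rwa [one_mul] at this

omit [Fintype α] in
/-- If `g u` lies in the open cell with `u ∈ U_n` then so does `g`. [folklore] -/
lemma mem_parabolicDoubleCoset_rev_of_mul_mem {g u : GL (Fin n) K}
    (hgu : g * u ∈ parabolicDoubleCoset (K := K) c Fin.revPerm) (hu : u ∈ upperUnitriangular (Fin n) K) :
    g ∈ parabolicDoubleCoset (K := K) c Fin.revPerm := by
  have := mul_upperUnitriangular_mem_parabolicDoubleCoset_rev (K := K) (c := c) hgu (Subgroup.inv_mem _ hu)
  rwa [mul_inv_cancel_right] at this

end Algebra

/-! ### Continuity of the radical part -/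

section Topology

variable {F : Type*} [Field F] [ValuativeRel F] [TopologicalSpace F] [IsNonarchimedeanLocalField F]
  {n : ℕ} {α : Type*} [LinearOrder α] (c : Fin n → α)

/-- The block diagonal part `ℓ : U_n → GL_n(F)` is continuous. [folklore] -/
theorem continuous_cellLeviPart [Fintype α] (hc : Monotone c) :
    Continuous (cellLeviPart (K := F) c hc) := by
  unfold cellLeviPart
  refine (continuous_blockDiagonalGL F (⇑toDual ∘ revLabel c)).comp
    ((continuous_leviProjection F (⇑toDual ∘ revLabel c)).comp ?_)
  exact Continuous.subtype_mk continuous_subtype_val _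

/-- The radical part `n : U_n → GL_n(F)` is continuous. [folklore] -/
theorem continuous_cellRadicalPart [Fintype α] (hc : Monotone c) :
    Continuous (cellRadicalPart (K := F) c hc) :=
  ((continuous_cellLeviPart c hc).inv).mul continuous_subtype_val

end Topology

end Literature.NumberTheory.Automorphic
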